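import Mathlib
import HarnessLib

/-!
# CharDial / JLinPeel — ADAPTED DIAL, part A: the abstract DOEBLIN (coupling) lemma for time-inhomogeneous doubly-stochastic kernels
(route `CharDial`, item 32604; lens-6 node g18 §11.7 (ii), engine step (γ) of the sixth dial «adapted few-column strategies»)

For a sequence of row-stochastic kernels `K j` on a finite state space, each with column sums one (so the uniform law is invariant) and each MINORISED
by the uniform law, `η / |S| ≤ K j s t` (`η < 1`), the law `pushIter μ K k` of a chain started from ANY law `μ` and pushed through `K 0, …, K (k−1)`
satisfies, for every event `A`,  `|pushIter μ K k (A) − |A| / |S|| ≤ (1 − η)^k`  (`doeblin`).  Proof: the Doeblin decomposition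
`pushIter μ K k = (1 − (1−η)^k)·uniform + (1−η)^k·ν_k` with `ν_k` a law (`pushIter_decomp`).  No spectral theory; time-inhomogeneity is irrelevant.
0 sorry.
-/

set_option autoImplicit false

namespace Summit.QuantumAdvantage.AdviceFreeQNC0.JLinPeel.AdaptDial

open Finset

variable {S : Type*} [Fintype S]

/-- a probability law on the finite state space `S`, as a non-negative real function summing to one. -/
def IsLaw (μ : S → ℝ) : Prop := (∀ s, 0 ≤ μ s) ∧ ∑ s, μ s = 1

/-- a row-stochastic kernel. -/
def IsStochastic (K : S → S → ℝ) : Prop := (∀ s t, 0 ≤ K s t) ∧ ∀ s, ∑ t, K s t = 1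

/-- column sums one (together with `IsStochastic`: doubly stochastic; the uniform law is invariant). -/
def ColSumOne (K : S → S → ℝ) : Prop := ∀ t, ∑ s, K s t = 1

/-- DOEBLIN MINORISATION by the uniform law with constant `η`: every transition probability is at least `η / |S|`. -/
def Minorised (η : ℝ) (K : S → S → ℝ) : Prop := ∀ s t, η / Fintype.card S ≤ K s t

/-- push a law through a kernel: `(push μ K) t = Σ_s μ s · K s t`. -/
def push (μ : S → ℝ) (K : S → S → ℝ) : S → ℝ := fun t => ∑ s, μ s * K s t

/-- the law after the kernels `K 0, …, K (k−1)` (time-inhomogeneous chain). -/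
def pushIter (μ : S → ℝ) (K : ℕ → S → S → ℝ) : ℕ → S → ℝ
  | 0 => μ
  | k + 1 => push (pushIter μ K k) (K k)

/-- pushing a law through a stochastic kernel gives a law. -/
theorem push_isLaw (μ : S → ℝ) (hμ : IsLaw μ) (K : S → S → ℝ) (hK : IsStochastic K) : IsLaw (push μ K) := by
  refine ⟨fun t => Finset.sum_nonneg fun s _ => mul_nonneg (hμ.1 s) (hK.1 s t), ?_⟩
  unfold push
  rw [Finset.sum_comm]
  simp_rw [← Finset.mul_sum, hK.2, mul_one, hμ.2]

/-- the uniform law is invariant under a kernel with column sums one: the constant part passes through unchanged. -/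
theorem push_const (c : ℝ) (K : S → S → ℝ) (hC : ColSumOne K) (t : S) : push (fun _ => c) K t = c := by
  unfold push
  rw [← Finset.mul_sum, hC t, mul_one]

/-- `push` is additive and homogeneous in the law (the form used below). -/
theorem push_add_smul (c r : ℝ) (ν : S → ℝ) (K : S → S → ℝ) (t : S) :
    push (fun s => c + r * ν s) K t = push (fun _ => c) K t + r * push ν K t := by
  unfold push
  rw [Finset.mul_sum, ← Finset.sum_add_distrib]
  refine Finset.sum_congr rfl fun s _ => ?_
  ring

/-- ONE DOEBLIN STEP: a minorised stochastic kernel sends any law `ν` to `η·uniform + (1−η)·ν'` with `ν'` a law. -/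
theorem push_decomp [Nonempty S] (η : ℝ) (hη1 : η < 1) (K : S → S → ℝ) (hK : IsStochastic K) (hM : Minorised η K)
    (ν : S → ℝ) (hν : IsLaw ν) :
    ∃ ν' : S → ℝ, IsLaw ν' ∧ ∀ t, push ν K t = η / Fintype.card S + (1 - η) * ν' t := by
  have hcard : (Fintype.card S : ℝ) ≠ 0 := Nat.cast_ne_zero.mpr Fintype.card_ne_zero
  have h1η : (1 - η) ≠ 0 := by linarith
  refine ⟨fun t => (∑ s, ν s * (K s t - η / Fintype.card S)) / (1 - η), ⟨fun t => ?_, ?_⟩, fun t => ?_⟩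
  · exact div_nonneg (Finset.sum_nonneg fun s _ => mul_nonneg (hν.1 s) (by linarith [hM s t])) (by linarith)
  · rw [← Finset.sum_div, div_eq_one_iff_eq h1η, Finset.sum_comm]
    have hin : ∀ s, ∑ t, ν s * (K s t - η / Fintype.card S) = ν s * (1 - η) := by
      intro s
      rw [← Finset.mul_sum, Finset.sum_sub_distrib, hK.2 s, Finset.sum_const, Finset.card_univ, nsmul_eq_mul,
        mul_div_cancel₀ _ hcard]
    simp_rw [hin, ← Finset.sum_mul, hν.2, one_mul]
  · have hx : (1 - η) * ((∑ s, ν s * (K s t - η / Fintype.card S)) / (1 - η)) = ∑ s, ν s * (K s t - η / Fintype.card S) := by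
      rw [mul_div_assoc', mul_div_cancel_left₀ _ h1η]
    rw [hx]
    unfold push
    simp_rw [mul_sub, Finset.sum_sub_distrib, ← Finset.sum_mul, hν.2, one_mul]
    ring

/-- ★ **the DOEBLIN DECOMPOSITION** of the time-inhomogeneous chain: after `k` minorised doubly-stochastic steps the law is
`(1 − (1−η)^k)·uniform + (1−η)^k·ν_k` with `ν_k` a law. -/
theorem pushIter_decomp [Nonempty S] (η : ℝ) (hη1 : η < 1) (K : ℕ → S → S → ℝ)
    (hK : ∀ j, IsStochastic (K j)) (hC : ∀ j, ColSumOne (K j)) (hM : ∀ j, Minorised η (K j))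
    (μ : S → ℝ) (hμ : IsLaw μ) (k : ℕ) :
    ∃ ν : S → ℝ, IsLaw ν ∧ ∀ t, pushIter μ K k t = (1 - (1 - η) ^ k) / Fintype.card S + (1 - η) ^ k * ν t := by
  induction k with
  | zero => exact ⟨μ, hμ, fun t => by simp [pushIter]⟩
  | succ k ih =>
    obtain ⟨ν, hν, hk⟩ := ih
    obtain ⟨ν', hν', hstep⟩ := push_decomp η hη1 (K k) (hK k) (hM k) ν hν
    refine ⟨ν', hν', fun t => ?_⟩
    have hfun : pushIter μ K k = fun s => (1 - (1 - η) ^ k) / Fintype.card S + (1 - η) ^ k * ν s := funext hk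
    show push (pushIter μ K k) (K k) t = _
    rw [hfun, push_add_smul, push_const _ _ (hC k), hstep t]
    ring

/-- ★★ **DOEBLIN'S BOUND (time-inhomogeneous, coupling form).** for every event `A`, the chain's law after `k` minorised doubly-stochastic steps is
within `(1−η)^k` of the uniform law on `A`. -/
theorem doeblin [Nonempty S] (η : ℝ) (hη1 : η < 1) (K : ℕ → S → S → ℝ)
    (hK : ∀ j, IsStochastic (K j)) (hC : ∀ j, ColSumOne (K j)) (hM : ∀ j, Minorised η (K j))
    (μ : S → ℝ) (hμ : IsLaw μ) (k : ℕ) (A : Finset S) :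
    |∑ s ∈ A, pushIter μ K k s - A.card / Fintype.card S| ≤ (1 - η) ^ k := by
  obtain ⟨ν, hν, hk⟩ := pushIter_decomp η hη1 K hK hC hM μ hμ k
  have hcard : (0 : ℝ) < Fintype.card S := Nat.cast_pos.mpr Fintype.card_pos
  have hr0 : (0 : ℝ) ≤ (1 - η) ^ k := pow_nonneg (by linarith) k
  have hνA0 : 0 ≤ ∑ s ∈ A, ν s := Finset.sum_nonneg fun s _ => hν.1 s
  have hνA1 : ∑ s ∈ A, ν s ≤ 1 := by
    calc ∑ s ∈ A, ν s ≤ ∑ s, ν s := Finset.sum_le_sum_of_subset_of_nonneg (Finset.subset_univ A) fun s _ _ => hν.1 s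
      _ = 1 := hν.2
  have hA0 : (0 : ℝ) ≤ A.card / Fintype.card S := by positivity
  have hA1 : (A.card : ℝ) / Fintype.card S ≤ 1 := by
    rw [div_le_one hcard]
    exact_mod_cast Finset.card_le_univ A
  have hsum : ∑ s ∈ A, pushIter μ K k s = A.card * ((1 - (1 - η) ^ k) / Fintype.card S) + (1 - η) ^ k * ∑ s ∈ A, ν s := by
    simp_rw [hk, Finset.sum_add_distrib, Finset.sum_const, nsmul_eq_mul, ← Finset.mul_sum]
  rw [hsum]
  have hrew : (A.card : ℝ) * ((1 - (1 - η) ^ k) / Fintype.card S) + (1 - η) ^ k * ∑ s ∈ A, ν s - A.card / Fintype.card S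
      = (1 - η) ^ k * (∑ s ∈ A, ν s - A.card / Fintype.card S) := by ring
  rw [hrew, abs_mul, abs_of_nonneg hr0]
  calc (1 - η) ^ k * |∑ s ∈ A, ν s - A.card / Fintype.card S| ≤ (1 - η) ^ k * 1 :=
        mul_le_mul_of_nonneg_left (abs_sub_le_iff.mpr ⟨by linarith, by linarith⟩) hr0
    _ = (1 - η) ^ k := mul_one _

/-- the READOUT form used by the dial: a Boolean statistic of the final state whose uniform average is exactly `1/2` (e.g. one coordinate of a
uniformly distributed even-weight parity vector) is `(1−η)^k`-close to unbiased. -/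
theorem doeblin_readout [Nonempty S] [DecidableEq S] (η : ℝ) (hη1 : η < 1) (K : ℕ → S → S → ℝ)
    (hK : ∀ j, IsStochastic (K j)) (hC : ∀ j, ColSumOne (K j)) (hM : ∀ j, Minorised η (K j))
    (μ : S → ℝ) (hμ : IsLaw μ) (k : ℕ) (f : S → Bool) (hf : 2 * (univ.filter fun s => f s = true).card = Fintype.card S) :
    |∑ s ∈ univ.filter (fun s => f s = true), pushIter μ K k s - 1 / 2| ≤ (1 - η) ^ k := by
  have hcard : (Fintype.card S : ℝ) ≠ 0 := Nat.cast_ne_zero.mpr Fintype.card_ne_zero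
  have h := doeblin η hη1 K hK hC hM μ hμ k (univ.filter fun s => f s = true)
  have hhalf : ((univ.filter fun s => f s = true).card : ℝ) / Fintype.card S = 1 / 2 := by
    rw [div_eq_div_iff hcard two_ne_zero, one_mul]
    exact_mod_cast (by simpa [mul_comm] using hf)
  rwa [hhalf] at h

end Summit.QuantumAdvantage.AdviceFreeQNC0.JLinPeel.AdaptDial
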